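import Summits.AtomisticToContinuum.HydrodynamicLimit.Theses.RingDensityCertificate
import Literature.MathematicalPhysics.KineticTheory.HardSphereTwoTimePressure
import HarnessLib

/-!
# `SmallDataRingSparsity` (support item stmt-AtomisticToContinuum-12132, route `RingDensityCertificate`)

Helper file (`--supports stmt-AtomisticToContinuum-12132`) recording what the route's three
equilibrium-side ingredients give for the support item `SmallDataRingSparsity` (small-data
tree-likeness of collision histories for ALL times: for near-constant local Gibbs data the
probability that the `M`-ring collisions exceed a fraction `δ` of all collisions in a cell
`B(x₀,h) × [t, t + w_N]` tends to `0`).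

* `tendsto_measure_of_ld_of_tilt` — the abstract glue: an extensive large-deviation bound
  `Q_N(B_N) ≤ C e^{-(N+1)/C}` under the reference law and an `L²` (Cauchy–Schwarz) tilt bound
  `P_N(S) ≤ e^{Λ(N+1)} Q_N(S)^{1/2}` with `Λ < 1/(2C)` give `P_N(A_N) → 0` for `A_N ⊆ B_N`
  (Kipnis–Landim 1999, Ch. 10 form of the transfer; no measurability of `A_N` needed).
* `smallDataRingSparsity_of_one_le` — the regime `δ ≥ 1` of the route decl, unconditionally:
  on the good set of the flow every window collision-time set is finite
  (`IsHardSphereTrajectory.locFinite`), so `Z_ring ≤ Z_coll` and the event is Liouville-null,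
  hence null for the (absolutely continuous) local Gibbs law.
* `smallDataRingSparsity_hFirst_of` — the decl with the cell radius `h` quantified BEFORE the
  amplitude `η₀` follows from `EquilibriumRingLD` (stmt-12130, verbatim) + a QUANTITATIVE tilt
  bound (for every `Λ > 0` an amplitude `η₀`; the filed `TiltTransfer` stmt-12131 gives only an
  unquantified `Λ`) + eventual smallness `r_E(N) ≤ δ` of the equilibrium ring fraction (the
  Enskog-level re-aiming estimate named in the item's informal text; not a filed item).

What is deliberately NOT here: the decl as filed (`∃ η₀` before `∀ h`). The large-deviation
constant of `EquilibriumRingLD` is `C = C(h)` (rate `∝ h³ N` for a cell of volume `∝ h³`) while the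
tilt is global (`e^{Λ(η₀)(N+1)}`), so `Λ(η₀) < 1/(2C(h))` cannot hold for all `h` once `η₀` is fixed:
the filed order makes the item a genuinely non-equilibrium local statement (crux-grade), which this
prover reports as misstated with the `h`-first restatement proved here modulo the three hypotheses.

References: C. Kipnis, C. Landim, *Scaling Limits of Interacting Particle Systems* (1999), Ch. 10;
S. Janson, *Large deviations for sums of partly dependent random variables* (2004), Thm 2.1;
K. Aoki, M. Pulvirenti, S. Simonella, T. Tsuji, M3AS 25 (2015), Thm 1 (backward clusters);
J. R. Dorfman, *An Introduction to Chaos in Nonequilibrium Statistical Mechanics* (1999), §16.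
-/

noncomputable section

namespace Summit.AtomisticToContinuum.HydrodynamicLimit.Theorems

namespace SmallDataRingSparsity

open MeasureTheory Filter Set Topology
open scoped ENNReal
open Literature.Analysis.FluidPDE Literature.MathematicalPhysics.KineticTheory

/-! ### Abstract glue: large deviations under `Q` + an `L²` tilt `P ≤ e^{Λ(N+1)} Q^{1/2}` -/

/-- Pointwise inclusion of the ring-excess event in the large-deviation event: if
`δ·Zc < Zr`, `0 ≤ Zc`, and the centring ratio satisfies `r ≤ δ/2`, then
`(δ/2)·Zc < |Zr - r·Zc|`. [folklore] -/
theorem half_mul_lt_abs_sub_of_mul_lt {δ zc zr r : ℝ} (h : δ * zc < zr) (hzc : 0 ≤ zc)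
    (hr : r ≤ δ / 2) : δ / 2 * zc < |zr - r * zc| := by
  have h1 : r * zc ≤ δ / 2 * zc := mul_le_mul_of_nonneg_right hr hzc
  have h2 : δ / 2 * zc < zr - r * zc := by linarith
  exact lt_of_lt_of_le h2 (le_abs_self _)

/-- **Abstract LD + tilt glue.** Let `P N`, `Q N` be measures and `A N ⊆ B N` eventually. If
`Q N (B N) ≤ C e^{-(N+1)/C}` for all `N` (an extensive large-deviation bound) and
`P N S ≤ e^{Λ (N+1)} (Q N S)^{1/2}` for every measurable `S` (an `L²`/Cauchy–Schwarz tilt bound) with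
`Λ < 1/(2C)`, then `P N (A N) → 0`. Measurability of `A N` is not needed (pass to a
`Q N`-measurable hull). [folklore] -/
theorem tendsto_measure_of_ld_of_tilt {Ω : ℕ → Type*} [∀ N, MeasurableSpace (Ω N)]
    (P Q : ∀ N, Measure (Ω N)) (A B : ∀ N, Set (Ω N)) {C Λ : ℝ} (hC : 0 < C)
    (hΛ : Λ < 1 / (2 * C)) (hAB : ∀ᶠ N in atTop, A N ⊆ B N)
    (hLD : ∀ N : ℕ, Q N (B N) ≤ ENNReal.ofReal (C * Real.exp (-(C⁻¹ * (N + 1)))))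
    (htilt : ∀ (N : ℕ) (S : Set (Ω N)), MeasurableSet S →
      P N S ≤ ENNReal.ofReal (Real.exp (Λ * (N + 1))) * (Q N S) ^ (1 / 2 : ℝ)) :
    Tendsto (fun N => P N (A N)) atTop (𝓝 0) := by
  -- the real majorant `√C · exp ((Λ - 1/(2C)) (N+1))` tends to `0`
  have hf_eq : ∀ N : ℕ, Real.exp (Λ * (N + 1)) * Real.sqrt (C * Real.exp (-(C⁻¹ * (N + 1)))) =
      Real.sqrt C * Real.exp ((Λ - 1 / (2 * C)) * (N + 1)) := by
    intro N
    rw [Real.sqrt_mul hC.le, ← Real.exp_half, mul_comm, mul_assoc, ← Real.exp_add]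
    congr 2
    field_simp
    ring
  have hf_tendsto : Tendsto (fun N : ℕ => Real.exp (Λ * (N + 1)) *
      Real.sqrt (C * Real.exp (-(C⁻¹ * (N + 1))))) atTop (𝓝 0) := by
    have hneg : Λ - 1 / (2 * C) < 0 := by linarith
    have h1 : Tendsto (fun N : ℕ => (Λ - 1 / (2 * C)) * ((N : ℝ) + 1)) atTop atBot := by
      have h2 : Tendsto (fun N : ℕ => ((N : ℝ) + 1)) atTop atTop :=
        tendsto_natCast_atTop_atTop.atTop_add tendsto_const_nhds
      exact h2.const_mul_atTop_of_neg hneg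
    have h3 : Tendsto (fun N : ℕ => Real.exp ((Λ - 1 / (2 * C)) * ((N : ℝ) + 1))) atTop (𝓝 0) :=
      Real.tendsto_exp_atBot.comp h1
    have h4 := h3.const_mul (Real.sqrt C)
    rw [mul_zero] at h4
    exact h4.congr' (Eventually.of_forall fun N => (hf_eq N).symm)
  -- squeeze
  have hup : ∀ᶠ N in atTop, P N (A N) ≤ ENNReal.ofReal (Real.exp (Λ * (N + 1)) *
      Real.sqrt (C * Real.exp (-(C⁻¹ * (N + 1))))) := by
    filter_upwards [hAB] with N hN
    set S := toMeasurable (Q N) (A N) with hS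
    calc P N (A N) ≤ P N S := measure_mono (subset_toMeasurable _ _)
      _ ≤ ENNReal.ofReal (Real.exp (Λ * (N + 1))) * (Q N S) ^ (1 / 2 : ℝ) :=
          htilt N S (measurableSet_toMeasurable _ _)
      _ = ENNReal.ofReal (Real.exp (Λ * (N + 1))) * (Q N (A N)) ^ (1 / 2 : ℝ) := by
          rw [hS, measure_toMeasurable]
      _ ≤ ENNReal.ofReal (Real.exp (Λ * (N + 1))) *
            (ENNReal.ofReal (C * Real.exp (-(C⁻¹ * (N + 1))))) ^ (1 / 2 : ℝ) := by
          gcongr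
          exact (measure_mono hN).trans (hLD N)
      _ = ENNReal.ofReal (Real.exp (Λ * (N + 1)) *
            Real.sqrt (C * Real.exp (-(C⁻¹ * (N + 1))))) := by
          rw [ENNReal.ofReal_rpow_of_nonneg (by positivity) (by norm_num),
            ← ENNReal.ofReal_mul (Real.exp_pos _).le, Real.sqrt_eq_rpow]
  have hup' : Tendsto (fun N : ℕ => ENNReal.ofReal (Real.exp (Λ * (N + 1)) *
      Real.sqrt (C * Real.exp (-(C⁻¹ * (N + 1)))))) atTop (𝓝 0) := by
    rw [← ENNReal.ofReal_zero]
    exact ENNReal.tendsto_ofReal hf_tendsto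
  exact tendsto_of_tendsto_of_tendsto_of_le_of_le' tendsto_const_nhds hup'
    (Eventually.of_forall fun N => zero_le) hup

/-! ### Pair sums of finite sums over collision-time sets -/

/-- Ordered-pair sums of finite sums of a nonnegative function are nonnegative (no finiteness
needed: an infinite `finsum` is `0`). [folklore] -/
theorem pairSum_finsum_nonneg {n : ℕ} (T : Fin n → Fin n → Set ℝ) (f : Fin n → Fin n → ℝ → ℝ)
    (hf : ∀ i j s, 0 ≤ f i j s) :
    0 ≤ ∑ i : Fin n, ∑ j : Fin n, if i ≠ j then ∑ᶠ s ∈ T i j, f i j s else 0 := by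
  refine Finset.sum_nonneg fun i _ => Finset.sum_nonneg fun j _ => ?_
  split_ifs
  · exact finsum_nonneg fun s => finsum_nonneg fun _ => hf i j s
  · exact le_rfl

/-- Over FINITE index sets, the pair sum of indicator counts is at most the pair sum of plain
counts (`Z_ring ≤ Z_coll`). Finiteness is essential: with an infinite `T i j` the right-hand
`finsum` is the junk value `0`. [folklore] -/
theorem pairSum_finsum_indicator_le {n : ℕ} (T : Fin n → Fin n → Set ℝ)
    (E : Fin n → Fin n → Set ℝ) (hT : ∀ i j, i ≠ j → (T i j).Finite) :
    (∑ i : Fin n, ∑ j : Fin n, if i ≠ j then ∑ᶠ s ∈ T i j, Set.indicator (E i j) 1 s else 0) ≤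
      ∑ i : Fin n, ∑ j : Fin n, if i ≠ j then ∑ᶠ s ∈ T i j, (1 : ℝ) else 0 := by
  refine Finset.sum_le_sum fun i _ => Finset.sum_le_sum fun j _ => ?_
  split_ifs with hij
  · rw [finsum_mem_eq_finite_toFinset_sum _ (hT i j hij),
      finsum_mem_eq_finite_toFinset_sum _ (hT i j hij)]
    refine Finset.sum_le_sum fun s _ => ?_
    exact Set.indicator_le_self' (fun _ _ => zero_le_one) s
  · exact le_rfl

/-- If `1 ≤ δ`, `0 ≤ Zc` and `Zr ≤ Zc` then `δ·Zc < Zr` is impossible. [folklore] -/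
theorem not_mul_lt_of_one_le {δ zc zr : ℝ} (hδ : 1 ≤ δ) (hzc : 0 ≤ zc) (hle : zr ≤ zc) :
    ¬ δ * zc < zr := by
  intro h
  nlinarith

/-! ### The trivial regime `δ ≥ 1` of `SmallDataRingSparsity` -/

/-- **`SmallDataRingSparsity` in the regime `δ ≥ 1` (ring count never exceeds the collision
count).** Same statement as the route decl `RingDensityCertificate.SmallDataRingSparsity` with
`0 < δ` replaced by `1 ≤ δ`: then the event `{δ·Z_coll < Z_ring}` is contained in the complement
of the good set of the flow — on a good orbit the collision times in a bounded window are finite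
(`IsHardSphereTrajectory.locFinite`), so every `Tc` is finite and `Z_ring ≤ Z_coll ≤ δ·Z_coll` —
and the local Gibbs law, being absolutely continuous with respect to the Liouville measure
(`localGibbsLaw_absolutelyContinuous`), gives it probability `0` for every `N`. The substantive
regime of the item is `δ < 1`. [folklore] -/
theorem smallDataRingSparsity_of_one_le :
    ∀ (c θc : ℝ), 0 < c → 0 < θc → ∀ M : ℝ, 0 < M → ∀ δ : ℝ, 1 ≤ δ → ∃ σ₀ : ℝ, 0 < σ₀ ∧ ∀ σ : ℝ, 0 < σ → σ < σ₀ → ∃ η₀ : ℝ, 0 < η₀ ∧ ∀ (a₀ θ₀ : UnitAddTorus (Fin 3) → ℝ) (u₀ : UnitAddTorus (Fin 3) → EuclideanSpace ℝ (Fin 3)), Continuous a₀ → Continuous θ₀ → Continuous u₀ → (∀ x, 0 < a₀ x) → (∀ x, 0 < θ₀ x) → (∀ x, |a₀ x - c| ≤ η₀ ∧ ‖u₀ x‖ ≤ η₀ ∧ |θ₀ x - θc| ≤ η₀) → ∀ Φ : (N : ℕ) → Literature.Analysis.FluidPDE.HardSphereFlow (Literature.Analysis.FluidPDE.Torus.geometry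 (Fin 3)) (Literature.MathematicalPhysics.KineticTheory.hsDiameter σ N) (N + 1), ∀ (t : ℝ) (h : ℝ), 0 < h → ∀ x₀ : UnitAddTorus (Fin 3), let w : ℕ → ℝ := fun N => M / (σ ^ 2 * (Real.sqrt (θc) * ((N + 1 : ℕ) : ℝ) ^ (1 / 3 : ℝ))); let Tc := fun (N : ℕ) (ε : ℝ) (γ : ℝ → Literature.Analysis.FluidPDE.Config (N + 1) (Fin 3) (UnitAddTorus (Fin 3))) (a ℓ r : ℝ) (i j : Fin (N + 1)) => {s : ℝ | s ∈ Set.Icc a (a + ℓ) ∧ γ s ∈ Literature.Analysis.FluidPDE.contactSet (Literature.Analysis.FluidPDE.Torus.geometry (Fin 3)) (N + 1) ε i j ∧ Literature.Analysis.FluidPDE.Torus.euclidDist (γ s i).1 x₀ < r}; let Bc := fun (N : ℕ) (ε : ℝ) (γ : ℝ → Literature.Analysis.FluidPDE.Config (N + 1) (Fin 3) (UnitAddTorus (Fin 3))) (a b : ℝ) (i : Fin (N + 1)) => {k : Fin (N + 1) | ∃ (m : ℕ) (p : Fin (m + 1) → Fin (N + 1)) (τ : Fin m → ℝ), p 0 =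 i ∧ p (Fin.last m) = k ∧ StrictAnti τ ∧ ∀ l : Fin m, τ l ∈ Set.Ico a b ∧ γ (τ l) ∈ Literature.Analysis.FluidPDE.contactSet (Literature.Analysis.FluidPDE.Torus.geometry (Fin 3)) (N + 1) ε (p l.castSucc) (p l.succ)}; let Zc := fun (N : ℕ) (ε : ℝ) (γ : ℝ → Literature.Analysis.FluidPDE.Config (N + 1) (Fin 3) (UnitAddTorus (Fin 3))) (a ℓ r : ℝ) => ∑ i : Fin (N + 1), ∑ j : Fin (N + 1), if i ≠ j then ∑ᶠ s ∈ Tc N ε γ a ℓ r i j, (1 : ℝ) else 0; let Zr := fun (N : ℕ) (ε : ℝ) (γ : ℝ → Literature.Analysis.FluidPDE.Config (N + 1) (Fin 3) (UnitAddTorus (Fin 3))) (a ℓ r : ℝ) => ∑ i : Fin (N + 1), ∑ j : Fin (N + 1), if i ≠ j then ∑ᶠ s ∈ Tc N ε γ a ℓ r i j, Set.indicator {s' : ℝ | ∃ k, k ∈ Bc N ε γ (s' - ℓ) s' i ∧ k ∈ Bc N ε γ (s' - ℓ) s' j} 1 s else 0; Filter.Tendsto (fun N : ℕ => Literature.MathematicalPhysics.KineticTheory.localGibbsLaw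 σ a₀ u₀ θ₀ N (Φ N) {z | δ * Zc N (Literature.MathematicalPhysics.KineticTheory.hsDiameter σ N) (fun s => (Φ N).flow s z) t (w N) h < Zr N (Literature.MathematicalPhysics.KineticTheory.hsDiameter σ N) (fun s => (Φ N).flow s z) t (w N) h}) Filter.atTop (nhds 0) := by
  intro _ θc _ _ M _ δ hδ
  refine ⟨1, one_pos, fun σ _ _ => ⟨1, one_pos, ?_⟩⟩
  intro a₀ θ₀ u₀ _ _ _ _ _ _ Φ t h _ x₀
  dsimp only
  refine (tendsto_congr (f₂ := fun _ => (0 : ℝ≥0∞)) fun N => ?_).mpr tendsto_const_nhds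
  refine measure_mono_null (fun z hz => Set.mem_compl ?_)
    ((localGibbsLaw_absolutelyContinuous σ a₀ u₀ θ₀ N (Φ N)) (Φ N).measure_compl_good)
  intro hgood
  refine absurd hz (not_mul_lt_of_one_le hδ
    (pairSum_finsum_nonneg _ _ fun _ _ _ => zero_le_one)
    (pairSum_finsum_indicator_le _ _ fun i j hij => ?_))
  exact (((Φ N).isTrajectory z hgood).locFinite _ _).subset
    fun s hs => ⟨⟨i, j, hij, hs.2.1⟩, hs.1⟩

/-! ### The reordered statement from the three equilibrium-side ingredients -/

/-- **The `h`-first form of `SmallDataRingSparsity` from its three ingredients.** Hypotheses: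
(1) `EquilibriumRingLD` (route item stmt-AtomisticToContinuum-12130, verbatim); (2) a
QUANTITATIVE Cauchy–Schwarz tilt bound at time `0` — for every `Λ > 0` there is `η₀ > 0` such that
for continuous positive profiles within `η₀` of the constants `(c, 0, θc)` the local Gibbs law
`P_N` satisfies `P_N(B) ≤ e^{Λ(N+1)} Q_N(B)^{1/2}` for all measurable `B`, `Q_N` the homogeneous
law `(1, 0, θc)` (the filed `TiltTransfer`, stmt-12131, only gives SOME `Λ` per profile, with no
smallness); (3) smallness of the equilibrium ring fraction — for `σ < σ₀(θc, M, δ)` the centring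
ratio `r_E(N)` of `EquilibriumRingLD` is eventually `≤ δ` (the Enskog-level re-aiming estimate the
route's informal text invokes; unfiled). Conclusion: the route decl `SmallDataRingSparsity` with
the cell radius quantified BEFORE the amplitude, `∀ h > 0, ∃ η₀ > 0, …` (in the filed decl `η₀`
precedes `h`, which the LD constant `C = C(h)` of (1) cannot serve). Proof: with `C = C(σ, h)` from
(1) at `δ/2` and `Λ = 1/(4C)` in (2), `P_N(δ Z_c < Z_r) ≤ e^{(N+1)/(4C)} (C e^{-(N+1)/C})^{1/2} → 0`,
using `{δ Z_c < Z_r} ⊆ {(δ/2) Z_c < |Z_r - r_E(N) Z_c|}` once `r_E(N) ≤ δ/2`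
(`tendsto_measure_of_ld_of_tilt`). [folklore] -/
theorem smallDataRingSparsity_hFirst_of
    (hLD : Summit.AtomisticToContinuum.HydrodynamicLimit.Theses.RingDensityCertificate.EquilibriumRingLD)
    (hTilt :
    ∀ (c θc σ : ℝ), 0 < c → 0 < θc → 0 < σ → σ < 1 / 4 → ∀ Λ : ℝ, 0 < Λ → ∃ η₀ : ℝ, 0 < η₀ ∧ ∀ (a₀ θ₀ : UnitAddTorus (Fin 3) → ℝ) (u₀ : UnitAddTorus (Fin 3) → EuclideanSpace ℝ (Fin 3)), Continuous a₀ → Continuous θ₀ → Continuous u₀ → (∀ x, 0 < a₀ x) → (∀ x, 0 < θ₀ x) → (∀ x, |a₀ x - c| ≤ η₀ ∧ ‖u₀ x‖ ≤ η₀ ∧ |θ₀ x - θc| ≤ η₀) → ∀ (N : ℕ) (Φ : Literature.Analysis.FluidPDE.HardSphereFlow (Literature.Analysis.FluidPDE.Torus.geometry (Fin 3)) (Literature.MathematicalPhysics.KineticTheory.hsDiameter σ N) (N + 1)) (B : Set (Literature.Analysis.FluidPDE.Config (N + 1) (Fin 3) (UnitAddTorus (Fin 3)))), MeasurableSet B →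 Literature.MathematicalPhysics.KineticTheory.localGibbsLaw σ a₀ u₀ θ₀ N Φ B ≤ ENNReal.ofReal (Real.exp (Λ * (N + 1))) * (Literature.MathematicalPhysics.KineticTheory.localGibbsLaw σ 1 0 (fun _ => θc) N Φ B) ^ (1 / 2 : ℝ))
    (hSmall :
    ∀ θc : ℝ, 0 < θc → ∀ M : ℝ, 0 < M → ∀ δ : ℝ, 0 < δ → ∃ σ₀ : ℝ, 0 < σ₀ ∧ ∀ σ : ℝ, 0 < σ → σ < σ₀ → ∀ h : ℝ, 0 < h → ∀ (t : ℝ) (x₀ : UnitAddTorus (Fin 3)) (Φ : (N : ℕ) → Literature.Analysis.FluidPDE.HardSphereFlow (Literature.Analysis.FluidPDE.Torus.geometry (Fin 3)) (Literature.MathematicalPhysics.KineticTheory.hsDiameter σ N) (N + 1)), let w : ℕ → ℝ := fun N => M / (σ ^ 2 * (Real.sqrt (θc) * ((N + 1 : ℕ) : ℝ) ^ (1 / 3 : ℝ))); let Tc := fun (N : ℕ) (ε : ℝ) (γ : ℝ → Literature.Analysis.FluidPDE.Config (N + 1) (Fin 3) (UnitAddTorus (Fin 3))) (a ℓ r : ℝ)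 (i j : Fin (N + 1)) => {s : ℝ | s ∈ Set.Icc a (a + ℓ) ∧ γ s ∈ Literature.Analysis.FluidPDE.contactSet (Literature.Analysis.FluidPDE.Torus.geometry (Fin 3)) (N + 1) ε i j ∧ Literature.Analysis.FluidPDE.Torus.euclidDist (γ s i).1 x₀ < r}; let Bc := fun (N : ℕ) (ε : ℝ) (γ : ℝ → Literature.Analysis.FluidPDE.Config (N + 1) (Fin 3) (UnitAddTorus (Fin 3))) (a b : ℝ) (i : Fin (N + 1)) => {k : Fin (N + 1) | ∃ (m : ℕ) (p : Fin (m + 1) → Fin (N + 1)) (τ : Fin m → ℝ), p 0 = i ∧ p (Fin.last m) = k ∧ StrictAnti τ ∧ ∀ l : Fin m, τ l ∈ Set.Ico a b ∧ γ (τ l) ∈ Literature.Analysis.FluidPDE.contactSet (Literature.Analysis.FluidPDE.Torus.geometry (Fin 3)) (N + 1) ε (p l.castSucc) (p l.succ)}; let Zc := fun (N : ℕ) (ε : ℝ) (γ : ℝ → Literature.Analysis.FluidPDE.Config (N + 1) (Fin 3) (UnitAddTorus (Fin 3))) (a ℓ r : ℝ) => ∑ i : Fin (N + 1), ∑ j :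 Fin (N + 1), if i ≠ j then ∑ᶠ s ∈ Tc N ε γ a ℓ r i j, (1 : ℝ) else 0; let Zr := fun (N : ℕ) (ε : ℝ) (γ : ℝ → Literature.Analysis.FluidPDE.Config (N + 1) (Fin 3) (UnitAddTorus (Fin 3))) (a ℓ r : ℝ) => ∑ i : Fin (N + 1), ∑ j : Fin (N + 1), if i ≠ j then ∑ᶠ s ∈ Tc N ε γ a ℓ r i j, Set.indicator {s' : ℝ | ∃ k, k ∈ Bc N ε γ (s' - ℓ) s' i ∧ k ∈ Bc N ε γ (s' - ℓ) s' j} 1 s else 0; let rE : ℕ → ℝ := fun N => (∫ z, Zr N (Literature.MathematicalPhysics.KineticTheory.hsDiameter σ N) (fun s => (Φ N).flow s z) t (w N) h ∂Literature.MathematicalPhysics.KineticTheory.localGibbsLaw σ 1 0 (fun _ => θc) N (Φ N)) / (∫ z, Zc N (Literature.MathematicalPhysics.KineticTheory.hsDiameter σ N) (fun s => (Φ N).flow s z) t (w N) h ∂Literature.MathematicalPhysics.KineticTheory.localGibbsLaw σ 1 0 (fun _ => θc) N (Φ N)); ∀ᶠ N : ℕ in Filter.atTop, rE N ≤ δ)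 :
    ∀ (c θc : ℝ), 0 < c → 0 < θc → ∀ M : ℝ, 0 < M → ∀ δ : ℝ, 0 < δ → ∃ σ₀ : ℝ, 0 < σ₀ ∧ ∀ σ : ℝ, 0 < σ → σ < σ₀ → ∀ h : ℝ, 0 < h → ∃ η₀ : ℝ, 0 < η₀ ∧ ∀ (a₀ θ₀ : UnitAddTorus (Fin 3) → ℝ) (u₀ : UnitAddTorus (Fin 3) → EuclideanSpace ℝ (Fin 3)), Continuous a₀ → Continuous θ₀ → Continuous u₀ → (∀ x, 0 < a₀ x) → (∀ x, 0 < θ₀ x) → (∀ x, |a₀ x - c| ≤ η₀ ∧ ‖u₀ x‖ ≤ η₀ ∧ |θ₀ x - θc| ≤ η₀) → ∀ Φ : (N : ℕ) → Literature.Analysis.FluidPDE.HardSphereFlow (Literature.Analysis.FluidPDE.Torus.geometry (Fin 3)) (Literature.MathematicalPhysics.KineticTheory.hsDiameter σ N) (N + 1), ∀ (t : ℝ) (x₀ : UnitAddTorus (Fin 3)), let w : ℕ → ℝ := fun N => M / (σ ^ 2 * (Real.sqrt (θc) * ((N + 1 : ℕ) : ℝ) ^ (1 / 3 : ℝ)));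 let Tc := fun (N : ℕ) (ε : ℝ) (γ : ℝ → Literature.Analysis.FluidPDE.Config (N + 1) (Fin 3) (UnitAddTorus (Fin 3))) (a ℓ r : ℝ) (i j : Fin (N + 1)) => {s : ℝ | s ∈ Set.Icc a (a + ℓ) ∧ γ s ∈ Literature.Analysis.FluidPDE.contactSet (Literature.Analysis.FluidPDE.Torus.geometry (Fin 3)) (N + 1) ε i j ∧ Literature.Analysis.FluidPDE.Torus.euclidDist (γ s i).1 x₀ < r}; let Bc := fun (N : ℕ) (ε : ℝ) (γ : ℝ → Literature.Analysis.FluidPDE.Config (N + 1) (Fin 3) (UnitAddTorus (Fin 3))) (a b : ℝ) (i : Fin (N + 1)) => {k : Fin (N + 1) | ∃ (m : ℕ) (p : Fin (m + 1) → Fin (N + 1)) (τ : Fin m → ℝ), p 0 = i ∧ p (Fin.last m) = k ∧ StrictAnti τ ∧ ∀ l : Fin m, τ l ∈ Set.Ico a b ∧ γ (τ l) ∈ Literature.Analysis.FluidPDE.contactSet (Literature.Analysis.FluidPDE.Torus.geometry (Fin 3)) (N + 1) ε (p l.castSucc) (p l.succ)}; let Zc := fun (N : ℕ) (ε : ℝ)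 (γ : ℝ → Literature.Analysis.FluidPDE.Config (N + 1) (Fin 3) (UnitAddTorus (Fin 3))) (a ℓ r : ℝ) => ∑ i : Fin (N + 1), ∑ j : Fin (N + 1), if i ≠ j then ∑ᶠ s ∈ Tc N ε γ a ℓ r i j, (1 : ℝ) else 0; let Zr := fun (N : ℕ) (ε : ℝ) (γ : ℝ → Literature.Analysis.FluidPDE.Config (N + 1) (Fin 3) (UnitAddTorus (Fin 3))) (a ℓ r : ℝ) => ∑ i : Fin (N + 1), ∑ j : Fin (N + 1), if i ≠ j then ∑ᶠ s ∈ Tc N ε γ a ℓ r i j, Set.indicator {s' : ℝ | ∃ k, k ∈ Bc N ε γ (s' - ℓ) s' i ∧ k ∈ Bc N ε γ (s' - ℓ) s' j} 1 s else 0; Filter.Tendsto (fun N : ℕ => Literature.MathematicalPhysics.KineticTheory.localGibbsLaw σ a₀ u₀ θ₀ N (Φ N) {z | δ * Zc N (Literature.MathematicalPhysics.KineticTheory.hsDiameter σ N) (fun s => (Φ N).flow s z) t (w N) h < Zr N (Literature.MathematicalPhysics.KineticTheory.hsDiameter σ N) (fun s => (Φ N).flow s z) t (w N) h}) Filter.atTop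 (nhds 0) := by
  intro c θc hc hθc M hM δ hδ
  obtain ⟨σ₁, hσ₁, h₁⟩ := hLD θc hθc M hM (δ / 2) (half_pos hδ)
  obtain ⟨σ₂, hσ₂, h₂⟩ := hSmall θc hθc M hM (δ / 2) (half_pos hδ)
  refine ⟨min (min σ₁ σ₂) (1 / 4), by positivity, ?_⟩
  intro σ hσ hσlt h hh
  have hσ₁' : σ < σ₁ := lt_of_lt_of_le hσlt ((min_le_left _ _).trans (min_le_left _ _))
  have hσ₂' : σ < σ₂ := lt_of_lt_of_le hσlt ((min_le_left _ _).trans (min_le_right _ _))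
  have hσ4 : σ < 1 / 4 := lt_of_lt_of_le hσlt (min_le_right _ _)
  obtain ⟨C, hC, hCb⟩ := h₁ σ hσ hσ₁' h hh
  have hΛ : (0 : ℝ) < 1 / (4 * C) := by positivity
  obtain ⟨η₀, hη₀, hη⟩ := hTilt c θc σ hc hθc hσ hσ4 (1 / (4 * C)) hΛ
  refine ⟨η₀, hη₀, ?_⟩
  intro a₀ θ₀ u₀ ha hθ hu ha0 hθ0 hclose Φ t x₀
  have hB := hCb t x₀ Φ
  have hS := h₂ σ hσ hσ₂' h hh t x₀ Φ
  dsimp only at hB hS ⊢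
  refine tendsto_measure_of_ld_of_tilt (Λ := 1 / (4 * C))
    (fun N => Literature.MathematicalPhysics.KineticTheory.localGibbsLaw σ a₀ u₀ θ₀ N (Φ N))
    (fun N => Literature.MathematicalPhysics.KineticTheory.localGibbsLaw σ 1 0 (fun _ => θc) N (Φ N))
    _ _ hC ?_ ?_ hB ?_
  · rw [one_div_lt_one_div (by positivity) (by positivity)]
    linarith
  · filter_upwards [hS] with N hN
    intro z hz
    exact half_mul_lt_abs_sub_of_mul_lt hz
      (pairSum_finsum_nonneg _ _ fun _ _ _ => zero_le_one) hN
  · intro N S hSm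
    exact hη a₀ θ₀ u₀ ha hθ hu ha0 hθ0 hclose N (Φ N) S hSm

end SmallDataRingSparsity

end Summit.AtomisticToContinuum.HydrodynamicLimit.Theorems

end
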